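import Literature.AlgebraicGeometry.ShimuraVarieties.UnitaryBallQuotientDatum
import Mathlib.Analysis.Normed.Module.FiniteDimension
import Mathlib.Topology.Order.LocalExtr

/-!
# Isometries of a positive definite hermitian form are uniformly bounded (crux
# `EndoscopicMiddleDegree.OrthogonalEnveloped`, stmt-HodgeConjecture-14300; `--supports`; seat c2, 2026-08-16)

Brick "(arch), definite places" of the registered residual stub `stub_properlyDiscontinuous` (via
`stub_archimedeanBound`): if `Hc` is a positive definite complex matrix then every `g` with `gᴴ Hc g = Hc`
has all entries bounded by a constant depending on `Hc` only — the compactness of `U(H^τ)` at the places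
`τ` where the datum's form is definite (`UnitaryBallQuotientDatum.posDef_of_ne`). Proof: the real quadratic
form `q v = re (vᴴ Hc v)` is continuous and positive on the compact unit sphere, so `q v ≥ c ‖v‖²` with
`c > 0`; for the `j`-th column `w = g e_j`, `c ‖w‖² ≤ q w = q e_j = re (Hc j j)`.

* `stub_definiteUnitaryBounded` (REGISTERED stub of the crux).

References: A. Borel, *Introduction aux groupes arithmétiques* (1969), §8 (compact factors); BMM arXiv:1306.1515 Part 2 §1.1.
-/

noncomputable section

-- The crux-workfile namespace `Summit.<P>.<Sub>.Cruxes.…` repeats `HodgeConjecture` (single-conjunct summit).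
set_option linter.dupNamespace false

namespace Summit.HodgeConjecture.HodgeConjecture.Cruxes.OrthogonalEnveloped.HeckeGraphChow

open scoped BigOperators ComplexConjugate ComplexOrder
open Matrix Literature.AlgebraicGeometry.ShimuraVarieties

/-- The hermitian quadratic form is invariant under an isometry: `(g v)ᴴ Hc (g v) = vᴴ (gᴴ Hc g) v`.
[cite: BergeronMillsonMoeglin2016Balls, Part 2 §1.2] -/
theorem hermForm_mulVec_mulVec {n : Type*} [Fintype n] (Hc g : Matrix n n ℂ) (v : n → ℂ) :
    hermForm (starRingEnd ℂ) Hc (g *ᵥ v) (g *ᵥ v) = hermForm (starRingEnd ℂ) (gᴴ * Hc * g) v v := by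
  rw [hermForm_starRingEnd, hermForm_starRingEnd, star_mulVec, mulVec_mulVec, dotProduct_mulVec,
    vecMul_vecMul, ← Matrix.mul_assoc, ← dotProduct_mulVec]

/-- **A positive definite hermitian form dominates the sup norm**: `re (vᴴ Hc v) ≥ c ‖v‖²` for some
`c > 0` (minimum of the continuous positive form on the compact unit sphere, and homogeneity
`q (a • v) = |a|² q v`). [cite: BergeronMillsonMoeglin2016Balls, Part 2 §1.1] -/
theorem exists_pos_mul_norm_sq_le_re_hermForm {n : ℕ} {Hc : Matrix (Fin n) (Fin n) ℂ}
    (hH : Hc.PosDef) :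
    ∃ c : ℝ, 0 < c ∧ ∀ v : Fin n → ℂ, c * ‖v‖ ^ 2 ≤ (hermForm (starRingEnd ℂ) Hc v v).re := by
  rcases Nat.eq_zero_or_pos n with rfl | hn
  · refine ⟨1, one_pos, fun v ↦ ?_⟩
    have hv : v = 0 := Subsingleton.elim _ _
    subst hv
    simp [hermForm]
  -- the form as a continuous real function
  set q : (Fin n → ℂ) → ℝ := fun v ↦ (hermForm (starRingEnd ℂ) Hc v v).re with hq
  have hqc : Continuous q := by
    refine Complex.continuous_re.comp ?_
    exact (continuous_pi fun i ↦ (continuous_apply i).star).dotProduct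
      (continuous_const.matrix_mulVec continuous_id)
  -- positive on non-zero vectors
  have hqpos : ∀ v, v ≠ 0 → 0 < q v := by
    intro v hv
    have h := hH.dotProduct_mulVec_pos hv
    rw [Complex.lt_def] at h
    simpa [hq, hermForm_starRingEnd] using h.1
  -- homogeneity
  have hqsmul : ∀ (a : ℂ) (v : Fin n → ℂ), q (a • v) = ‖a‖ ^ 2 * q v := by
    intro a v
    simp only [hq]
    rw [hermForm_smul_smul, ← Complex.normSq_eq_conj_mul_self, Complex.re_ofReal_mul,
      Complex.normSq_eq_norm_sq]
  -- minimum on the unit sphere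
  have hS : IsCompact (Metric.sphere (0 : Fin n → ℂ) 1) := isCompact_sphere 0 1
  have hne : (Metric.sphere (0 : Fin n → ℂ) 1).Nonempty := by
    refine ⟨Pi.single ⟨0, hn⟩ 1, ?_⟩
    simp [Pi.norm_single]
  obtain ⟨v₀, hv₀S, hv₀⟩ := hS.exists_isMinOn hne hqc.continuousOn
  have hv₀ne : v₀ ≠ 0 := by
    intro h
    rw [h, Metric.mem_sphere, dist_zero_right, norm_zero] at hv₀S
    exact zero_ne_one hv₀S
  refine ⟨q v₀, hqpos v₀ hv₀ne, fun v ↦ ?_⟩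
  by_cases hv : v = 0
  · subst hv
    simp [hq, hermForm]
  · have hnv : ‖v‖ ≠ 0 := norm_ne_zero_iff.2 hv
    have hu : ((‖v‖⁻¹ : ℝ) : ℂ) • v ∈ Metric.sphere (0 : Fin n → ℂ) 1 := by
      rw [Metric.mem_sphere, dist_zero_right, norm_smul, Complex.norm_real, norm_inv, norm_norm,
        inv_mul_cancel₀ hnv]
    have hmin := hv₀ hu
    rw [Set.mem_setOf_eq, hqsmul, Complex.norm_real, norm_inv, norm_norm, inv_pow] at hmin
    have hpos : 0 < ‖v‖ ^ 2 := by positivity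
    calc q v₀ * ‖v‖ ^ 2 ≤ (‖v‖ ^ 2)⁻¹ * q v * ‖v‖ ^ 2 := by gcongr
      _ = q v := by field_simp

/-- **REGISTERED STUB `stub_definiteUnitaryBounded` (seat c2): isometries of a positive definite
hermitian form are uniformly bounded.** If `Hc` is positive definite then there is `C` with
`‖g i j‖ ≤ C` for every `g` with `gᴴ Hc g = Hc` and all `i, j` (the `j`-th column `w` of `g` has
`c ‖w‖² ≤ re (wᴴ Hc w) = re (Hc j j)`). [cite: BergeronMillsonMoeglin2016Balls, Part 2 §1.1] -/
theorem stub_definiteUnitaryBounded :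
    ∀ (n : ℕ) (Hc : Matrix (Fin n) (Fin n) ℂ), Hc.PosDef →
      ∃ C : ℝ, ∀ g : Matrix (Fin n) (Fin n) ℂ, gᴴ * Hc * g = Hc → ∀ i j, ‖g i j‖ ≤ C := by
  intro n Hc hH
  obtain ⟨c, hc, hcq⟩ := exists_pos_mul_norm_sq_le_re_hermForm hH
  refine ⟨Real.sqrt ((∑ j, ‖Hc j j‖) / c), fun g hg i j ↦ ?_⟩
  -- the `j`-th column of `g`
  set w : Fin n → ℂ := g *ᵥ Pi.single j 1 with hw
  have hwi : w i = g i j := by simp [hw, Matrix.mulVec_single]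
  -- `c ‖w‖² ≤ re (Hc j j)`
  have h1 : c * ‖w‖ ^ 2 ≤ (hermForm (starRingEnd ℂ) Hc (Pi.single j 1) (Pi.single j 1)).re := by
    have h := hcq w
    rwa [hw, hermForm_mulVec_mulVec, hg] at h
  have h2 : (hermForm (starRingEnd ℂ) Hc (Pi.single j 1) (Pi.single j 1)).re ≤ ∑ j, ‖Hc j j‖ := by
    have he : hermForm (starRingEnd ℂ) Hc (Pi.single j 1) (Pi.single j 1) = Hc j j := by
      simp [hermForm_starRingEnd, Matrix.mulVec_single, dotProduct, Pi.single_apply]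
    rw [he]
    exact (Complex.re_le_norm _).trans
      (Finset.single_le_sum (fun k _ ↦ norm_nonneg (Hc k k)) (Finset.mem_univ j))
  -- conclude
  have h3 : ‖g i j‖ ≤ ‖w‖ := by rw [← hwi]; exact norm_le_pi_norm w i
  have h4 : ‖w‖ ^ 2 ≤ (∑ j, ‖Hc j j‖) / c := by
    rw [le_div_iff₀ hc]
    linarith
  calc ‖g i j‖ ≤ ‖w‖ := h3
    _ = Real.sqrt (‖w‖ ^ 2) := (Real.sqrt_sq (norm_nonneg _)).symm
    _ ≤ Real.sqrt ((∑ j, ‖Hc j j‖) / c) := Real.sqrt_le_sqrt h4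

end Summit.HodgeConjecture.HodgeConjecture.Cruxes.OrthogonalEnveloped.HeckeGraphChow

end
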